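import Summits.QuantumFields.YangMills.Theorems.LuscherReductionOneSiteLevelsKacCross
import Summits.QuantumFields.YangMills.Theorems.LuscherReductionOneSiteLevelsKacMinMax
import Summits.QuantumFields.YangMills.Theorems.LuscherReductionOneSiteLevelsKacFlatten

/-!
# INNER, flat lane (layer III): assembly preparations — the datum `g`, the remainder `r = g − F`, bilinearity

Support module of crux `OneSiteLevels` (route `LuscherReduction`, item stmt-QuantumFields-20007), FLAT lane of the
registered v12 stub `stub_flatKacAL1` (STUB-PLAN rev 3 rows III.10/III.11, bookkeeping).

* §1 the datum of `FlatKacFormBound` (measurable, bounded, supported in a ball): integrability of `g`, `(1+‖x‖⁴)g²`, `V g²`;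
* §2 bilinearity of the Kac form on bounded measurable integrable functions:
  `kacForm t (u + v) = kacForm t u + 2 kacBil t u v + kacForm t v`;
* §3 the remainder `r = g − Σ c_j f_j` with `c_j = ⟨g, f_j⟩`: bounded, measurable, integrable, invariant, `(1+‖x‖⁴) r² ∈ L¹`,
  `r ⊥ f_j`, Pythagoras `∫ g² = ∫ r² + Σ c_j²`; the explicit span decay `|F| ≤ (Σ|c_j|) C_f e^{−‖x‖}` and the moment bound
  `∫ ‖x‖² F² ≤ M₂ Σ c_j²`; the almost-orthogonality budget `Σ_j ⟨P_{t/2} r, f_j⟩² ≤ t Θ ∫ r²`.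

Real analysis only ([folklore]); NOT the stub; femto rung R2b1; NOT a claim about the gap.
-/

set_option autoImplicit false

noncomputable section

open MeasureTheory Filter Topology Real
open Literature.Analysis.OperatorTheory.YMMatrixModel

namespace Summit.QuantumFields.YangMills.Theorems.FemtoTransferGap

/-! ### §1. The datum -/

section Datum

variable {g : ZM → ℝ} {M R : ℝ}

/-- Weighted squares of a bounded measurable ball-supported function are integrable: for a continuous weight `w`,
`w · g² ∈ L¹`. [folklore] -/
theorem integrable_weight_mul_sq_of_support (hm : Measurable g) (hb : ∀ x, |g x| ≤ M) (hsupp : ∀ x, g x ≠ 0 → ‖x‖ ≤ R)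
    {w : ZM → ℝ} (hw : Continuous w) : Integrable fun x => w x * g x ^ 2 := by
  -- `w` is bounded on the closed ball (compact); the product vanishes off the ball
  obtain ⟨B, hB⟩ : ∃ B, ∀ x ∈ Metric.closedBall (0 : ZM) R, |w x| ≤ B := by
    have hK : IsCompact (Metric.closedBall (0 : ZM) R) := isCompact_closedBall _ _
    obtain ⟨B, hB⟩ := hK.exists_bound_of_continuousOn hw.continuousOn
    exact ⟨B, fun x hx => by have := hB x hx; rwa [Real.norm_eq_abs] at this⟩
  have hM0 : 0 ≤ M := (abs_nonneg _).trans (hb 0)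
  refine integrable_of_bounded_of_support (hw.measurable.mul (hm.pow_const 2)) (M := |B| * M ^ 2) (R := R)
    (fun x => ?_) (fun x hx => hsupp x (fun h => hx (by rw [h]; ring)))
  by_cases hx : g x = 0
  · rw [hx]; simp; positivity
  · have hxR : x ∈ Metric.closedBall (0 : ZM) R := by rw [Metric.mem_closedBall, dist_zero_right]; exact hsupp x hx
    rw [abs_mul, abs_of_nonneg (sq_nonneg (g x))]
    have h1 : |w x| ≤ |B| := (hB x hxR).trans (le_abs_self B)
    have h2 : g x ^ 2 ≤ M ^ 2 := by rw [← sq_abs]; exact pow_le_pow_left₀ (abs_nonneg _) (hb x) 2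
    exact mul_le_mul h1 h2 (sq_nonneg _) (abs_nonneg _)

/-- The datum: `g ∈ L¹`, `(1+‖x‖⁴) g² ∈ L¹`, `V g² ∈ L¹`, `‖x‖² g² ∈ L¹`. [folklore] -/
theorem datum_integrable (hm : Measurable g) (hb : ∀ x, |g x| ≤ M) (hsupp : ∀ x, g x ≠ 0 → ‖x‖ ≤ R) :
    Integrable g ∧ Integrable (fun x => (1 + ‖x‖ ^ 4) * g x ^ 2) ∧ Integrable (fun x => luscherPotential x * g x ^ 2) ∧
      Integrable (fun x => ‖x‖ ^ 2 * g x ^ 2) ∧ Integrable (fun x => g x ^ 2) :=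
  ⟨integrable_of_bounded_of_support hm hb hsupp,
    integrable_weight_mul_sq_of_support hm hb hsupp (continuous_const.add (continuous_norm.pow 4)),
    integrable_weight_mul_sq_of_support hm hb hsupp continuous_luscherPotential,
    integrable_weight_mul_sq_of_support hm hb hsupp (continuous_norm.pow 2),
    integrable_sq_of_bounded_of_support hm hb hsupp⟩

end Datum

/-! ### §2. Bilinearity of the Kac form -/

section Bilinear

variable {t : ℝ} {u v : ZM → ℝ} {Mu Mv : ℝ}

/-- `P_t (u + v) = P_t u + P_t v` pointwise for bounded measurable data. [folklore] -/
theorem heatSmooth_add (ht : 0 < t) (hum : Measurable u) (hvm : Measurable v) (hub : ∀ y, |u y| ≤ Mu)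
    (hvb : ∀ y, |v y| ≤ Mv) (x : ZM) : heatSmooth t (u + v) x = heatSmooth t u x + heatSmooth t v x := by
  unfold heatSmooth
  rw [← integral_add (integrable_heatKernel_mul ht x hum hub) (integrable_heatKernel_mul ht x hvm hvb)]
  exact integral_congr_ae (Eventually.of_forall fun y => by simp only [Pi.add_apply]; ring)

/-- **Bilinearity of the Kac form** on bounded measurable integrable data with `V u², V v², V u v ∈ L¹`:
`kacForm t (u + v) = kacForm t u + 2 kacBil t u v + kacForm t v`. [folklore] -/
theorem kacForm_add (ht : 0 < t) (hum : Measurable u) (hvm : Measurable v) (hub : ∀ y, |u y| ≤ Mu)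
    (hvb : ∀ y, |v y| ≤ Mv) (hui : Integrable u) (hvi : Integrable v)
    (hVu : Integrable fun x => luscherPotential x * u x ^ 2) (hVv : Integrable fun x => luscherPotential x * v x ^ 2)
    (hVuv : Integrable fun x => luscherPotential x * (u x * v x)) :
    kacForm t (u + v) = kacForm t u + 2 * kacBil t u v + kacForm t v := by
  have hMu : 0 ≤ Mu := (abs_nonneg _).trans (hub 0)
  have hMv : 0 ≤ Mv := (abs_nonneg _).trans (hvb 0)
  have hwm : Measurable (u + v) := hum.add hvm
  have hwb : ∀ y, |(u + v) y| ≤ Mu + Mv := fun y => by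
    simp only [Pi.add_apply]; exact (abs_add_le _ _).trans (add_le_add (hub y) (hvb y))
  have hwi : Integrable (u + v) := hui.add hvi
  have hu2 : MemLp u 2 volume := memLp_two_of_bounded_integrable hum hub hui
  have hv2 : MemLp v 2 volume := memLp_two_of_bounded_integrable hvm hvb hvi
  -- closed forms
  rw [kacForm, kacForm, kacForm, kacBil, flatJump_eq_sub_inner ht hwm hwb hwi, flatJump_eq_sub_inner ht hum hub hui,
    flatJump_eq_sub_inner ht hvm hvb hvi, flatJumpBil_eq_sub_inner ht hum hvm hub hvb hui hvi]
  -- the pieces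
  have Iuu : Integrable fun x => u x ^ 2 := hu2.integrable_sq
  have Ivv : Integrable fun x => v x ^ 2 := hv2.integrable_sq
  have Iuv : Integrable fun x => u x * v x := hu2.integrable_mul hv2
  have hPu : Continuous (heatSmooth t u) := continuous_heatSmooth ht hui
  have hPv : Continuous (heatSmooth t v) := continuous_heatSmooth ht hvi
  have hPub : ∀ x, |heatSmooth t u x| ≤ Mu := abs_heatSmooth_le ht hub
  have hPvb : ∀ x, |heatSmooth t v x| ≤ Mv := abs_heatSmooth_le ht hvb
  have IuPu : Integrable fun x => u x * heatSmooth t u x :=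
    hui.mul_bdd (c := Mu) hPu.aestronglyMeasurable (ae_of_all _ fun x => by rw [Real.norm_eq_abs]; exact hPub x)
  have IuPv : Integrable fun x => u x * heatSmooth t v x :=
    hui.mul_bdd (c := Mv) hPv.aestronglyMeasurable (ae_of_all _ fun x => by rw [Real.norm_eq_abs]; exact hPvb x)
  have IvPu : Integrable fun x => v x * heatSmooth t u x :=
    hvi.mul_bdd (c := Mu) hPu.aestronglyMeasurable (ae_of_all _ fun x => by rw [Real.norm_eq_abs]; exact hPub x)
  have IvPv : Integrable fun x => v x * heatSmooth t v x :=
    hvi.mul_bdd (c := Mv) hPv.aestronglyMeasurable (ae_of_all _ fun x => by rw [Real.norm_eq_abs]; exact hPvb x)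
  -- `∫ (u+v)² = ∫u² + 2∫uv + ∫v²`
  have e1 : ∫ x, (u + v) x ^ 2 = (∫ x, u x ^ 2) + 2 * (∫ x, u x * v x) + ∫ x, v x ^ 2 := by
    have I12 : Integrable fun x => u x ^ 2 + 2 * (u x * v x) := Iuu.add (Iuv.const_mul _)
    rw [← integral_const_mul, ← integral_add Iuu (Iuv.const_mul _), ← integral_add I12 Ivv]
    exact integral_congr_ae (Eventually.of_forall fun x => by simp only [Pi.add_apply]; ring)
  have htr1 : ∫ x, u x * heatSmooth t v x = ∫ x, heatSmooth t u x * v x := (integral_heatSmooth_mul_comm ht hu2 hv2).symm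
  have htr2 : ∫ x, v x * heatSmooth t u x = ∫ x, heatSmooth t u x * v x :=
    integral_congr_ae (Eventually.of_forall fun x => by ring)
  -- `∫ (u+v)·P(u+v) = ∫ u Pu + 2∫ Pu v + ∫ v Pv`
  have e2 : ∫ x, (u + v) x * heatSmooth t (u + v) x =
      (∫ x, u x * heatSmooth t u x) + 2 * (∫ x, heatSmooth t u x * v x) + ∫ x, v x * heatSmooth t v x := by
    have e : ∀ x, (u + v) x * heatSmooth t (u + v) x =
        u x * heatSmooth t u x + u x * heatSmooth t v x + v x * heatSmooth t u x + v x * heatSmooth t v x := fun x => by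
      rw [heatSmooth_add ht hum hvm hub hvb x]; simp only [Pi.add_apply]; ring
    simp_rw [e]
    have I1 : Integrable fun x => u x * heatSmooth t u x + u x * heatSmooth t v x := IuPu.add IuPv
    have I2 : Integrable fun x => u x * heatSmooth t u x + u x * heatSmooth t v x + v x * heatSmooth t u x := I1.add IvPu
    rw [integral_add I2 IvPv, integral_add I1 IvPu, integral_add IuPu IuPv, htr1, htr2]
    ring
  -- potential: `∫ V (u+v)² = ∫Vu² + 2∫Vuv + ∫Vv²`
  have e3 : ∫ x, luscherPotential x * (u + v) x ^ 2 =
      (∫ x, luscherPotential x * u x ^ 2) + 2 * (∫ x, luscherPotential x * (u x * v x)) + ∫ x, luscherPotential x * v x ^ 2 := by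
    have I12 : Integrable fun x => luscherPotential x * u x ^ 2 + 2 * (luscherPotential x * (u x * v x)) := hVu.add (hVuv.const_mul _)
    rw [← integral_const_mul, ← integral_add hVu (hVuv.const_mul _), ← integral_add I12 hVv]
    exact integral_congr_ae (Eventually.of_forall fun x => by simp only [Pi.add_apply]; ring)
  rw [e1, e2, e3]
  ring

end Bilinear

/-! ### §3. The remainder `r = g − F` -/

section Remainder

variable {m : ℕ} {f : Fin (m + 1) → ZM → ℝ} (hf : IsEigenFamily m f)
include hf

omit hf in
/-- `(Σ_j |c_j|)² ≤ (m+1) Σ c_j²`. [folklore] -/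
theorem sq_sum_abs_le_card_mul (c : Fin (m + 1) → ℝ) : (∑ j, |c j|) ^ 2 ≤ (m + 1) * ∑ j, c j ^ 2 := by
  have h := sq_sum_le_card_mul_sum_sq (s := (Finset.univ : Finset (Fin (m + 1)))) (f := fun j => |c j|)
  simp only [Finset.card_univ, Fintype.card_fin, sq_abs] at h
  exact_mod_cast h

/-- **Explicit decay of the span**: `|F(x)| ≤ (Σ|c_j|) C_f e^{−‖x‖}` and `‖DF‖`-free companion for `∂F`, with a uniform `C_f`. [folklore] -/
theorem eigSpan_decay_explicit : ∃ C : ℝ, 0 ≤ C ∧ ∀ (c : Fin (m + 1) → ℝ) (x : ZM),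
    |eigSpan f c x| ≤ (∑ j, |c j|) * (C * Real.exp (-‖x‖)) ∧ ∀ p, |pderiv p (eigSpan f c) x| ≤ (∑ j, |c j|) * (C * Real.exp (-‖x‖)) := by
  obtain ⟨C, hC0, hC⟩ := exists_uniform_expDecay₂ hf.2.2.2.2
  have hd : ∀ j, Differentiable ℝ (f j) := fun j => differentiable_of_contDiff_two (hf.1 j 2)
  refine ⟨C, hC0, fun c x => ⟨?_, fun p => ?_⟩⟩
  · rw [eigSpan_apply]; exact abs_sum_mul_le_of_le x (fun j => (hC j x).1) c
  · rw [eigSpan_eq, pderiv_sum_mul hd c p x]; exact abs_sum_mul_le_of_le x (fun j => (hC j x).2.1 p) c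

/-- **Second moment of the span**: `∫ ‖x‖² F² ≤ M₂ Σ c_j²` with `M₂ = 2(m+1) C_f² ∫e^{−‖x‖}`. [folklore] -/
theorem integral_norm_sq_mul_eigSpan_sq_le : ∃ M₂ : ℝ, 0 ≤ M₂ ∧ ∀ c : Fin (m + 1) → ℝ,
    Integrable (fun x => ‖x‖ ^ 2 * eigSpan f c x ^ 2) ∧ ∫ x, ‖x‖ ^ 2 * eigSpan f c x ^ 2 ≤ M₂ * ∑ j, c j ^ 2 := by
  obtain ⟨C, hC0, hC⟩ := eigSpan_decay_explicit hf
  set I₉ : ℝ := ∫ x : ZM, Real.exp (-‖x‖) with hI₉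
  have hI0 : 0 ≤ I₉ := integral_nonneg fun x => (Real.exp_pos _).le
  refine ⟨2 * (m + 1) * C ^ 2 * I₉, by positivity, fun c => ?_⟩
  set S := ∑ j, |c j| with hS
  have hS0 : 0 ≤ S := Finset.sum_nonneg fun j _ => abs_nonneg _
  have hcont : Continuous fun x => ‖x‖ ^ 2 * eigSpan f c x ^ 2 :=
    (continuous_norm.pow 2).mul ((eigSpan_contDiff hf c 0).continuous.pow 2)
  -- pointwise: `‖x‖² F² ≤ S² C² ‖x‖² e^{-2‖x‖} ≤ 2 S² C² e^{-‖x‖}`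
  have hpt : ∀ x, ‖x‖ ^ 2 * eigSpan f c x ^ 2 ≤ (2 * S ^ 2 * C ^ 2) * Real.exp (-‖x‖) := by
    intro x
    have h1 := (hC c x).1
    have hsq : eigSpan f c x ^ 2 ≤ (S * (C * Real.exp (-‖x‖))) ^ 2 := by
      rw [← sq_abs]; exact pow_le_pow_left₀ (abs_nonneg _) h1 2
    have h2 : ‖x‖ ^ 2 * Real.exp (-‖x‖) ≤ 2 := by
      have h := Real.pow_div_factorial_le_exp ‖x‖ (norm_nonneg x) 2
      have hf2 : (Nat.factorial 2 : ℝ) = 2 := by norm_num [Nat.factorial]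
      rw [hf2, div_le_iff₀ (by norm_num : (0:ℝ) < 2)] at h
      rw [Real.exp_neg, mul_inv_le_iff₀ (Real.exp_pos _)]; linarith
    have he := Real.exp_pos (-‖x‖)
    calc ‖x‖ ^ 2 * eigSpan f c x ^ 2 ≤ ‖x‖ ^ 2 * (S * (C * Real.exp (-‖x‖))) ^ 2 :=
          mul_le_mul_of_nonneg_left hsq (sq_nonneg _)
      _ = S ^ 2 * C ^ 2 * (‖x‖ ^ 2 * Real.exp (-‖x‖)) * Real.exp (-‖x‖) := by ring
      _ ≤ S ^ 2 * C ^ 2 * 2 * Real.exp (-‖x‖) := by gcongr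
      _ = (2 * S ^ 2 * C ^ 2) * Real.exp (-‖x‖) := by ring
  have hint : Integrable fun x => ‖x‖ ^ 2 * eigSpan f c x ^ 2 :=
    (integrable_exp_neg_norm.const_mul _).mono' hcont.aestronglyMeasurable (Eventually.of_forall fun x => by
      rw [Real.norm_of_nonneg (mul_nonneg (sq_nonneg _) (sq_nonneg _))]; exact hpt x)
  refine ⟨hint, ?_⟩
  calc ∫ x, ‖x‖ ^ 2 * eigSpan f c x ^ 2 ≤ ∫ x, (2 * S ^ 2 * C ^ 2) * Real.exp (-‖x‖) :=
        integral_mono hint (integrable_exp_neg_norm.const_mul _) hpt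
    _ = 2 * S ^ 2 * C ^ 2 * I₉ := integral_const_mul _ _
    _ ≤ 2 * ((m + 1) * ∑ j, c j ^ 2) * C ^ 2 * I₉ := by
        have := sq_sum_abs_le_card_mul c; gcongr
    _ = 2 * (m + 1) * C ^ 2 * I₉ * ∑ j, c j ^ 2 := by ring

/-- **The remainder** `r = g − F`, `F = Σ c_j f_j`, `c_j = ⟨g, f_j⟩`, for the datum of `FlatKacFormBound`:
bounded, measurable, integrable, invariant, `(1+‖x‖⁴) r² ∈ L¹`, `V r² ∈ L¹`, `r ⊥ f_j`, and Pythagoras `∫g² = ∫r² + Σc_j²`.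
[folklore] -/
theorem remainder_package {g : ZM → ℝ} (hgm : Measurable g) {M R : ℝ} (hgb : ∀ x, |g x| ≤ M)
    (hsupp : ∀ x, g x ≠ 0 → ‖x‖ ≤ R) (hginv : IsGaugeInv g) (c : Fin (m + 1) → ℝ)
    (hc : ∀ j, c j = ∫ x, g x * f j x) :
    Measurable (g - eigSpan f c) ∧ (∃ M' : ℝ, ∀ x, |(g - eigSpan f c) x| ≤ M') ∧ Integrable (g - eigSpan f c) ∧
      IsGaugeInv (g - eigSpan f c) ∧ Integrable (fun x => (1 + ‖x‖ ^ 4) * (g - eigSpan f c) x ^ 2) ∧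
      Integrable (fun x => luscherPotential x * (g - eigSpan f c) x ^ 2) ∧
      Integrable (fun x => luscherPotential x * (eigSpan f c x * (g - eigSpan f c) x)) ∧
      (∀ j, ∫ x, (g - eigSpan f c) x * f j x = 0) ∧
      ∫ x, g x ^ 2 = (∫ x, (g - eigSpan f c) x ^ 2) + ∑ j, c j ^ 2 := by
  obtain ⟨hgi, hgw, hgV, -, hg2⟩ := datum_integrable hgm hgb hsupp
  obtain ⟨C, hC0, hC⟩ := eigSpan_decay hf c
  have hFK : IsKacFn (eigSpan f c) := isKacFn_span hf c
  have hFc : Continuous (eigSpan f c) := (eigSpan_contDiff hf c 0).continuous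
  have hFb : ∀ x, |eigSpan f c x| ≤ C := fun x =>
    ((hC x).1).trans (by nlinarith [Real.exp_le_one_iff.mpr (neg_nonpos.mpr (norm_nonneg x)), Real.exp_pos (-‖x‖)])
  obtain ⟨hFi, -, -, hF2, -⟩ := eigSpan_integrable hf c
  have hrm : Measurable (g - eigSpan f c) := hgm.sub hFc.measurable
  have hrb : ∀ x, |(g - eigSpan f c) x| ≤ M + C := fun x => by
    simp only [Pi.sub_apply]; exact (abs_sub _ _).trans (add_le_add (hgb x) (hFb x))
  have hri : Integrable (g - eigSpan f c) := hgi.sub hFi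
  have hrinv : IsGaugeInv (g - eigSpan f c) := fun Rm hRm x => by
    simp only [Pi.sub_apply]; rw [hginv Rm hRm x, hFK.gaugeInv Rm hRm x]
  -- weighted squares: `w r² ≤ 2 w g² + 2 w F²`
  have hwF : Integrable fun x => (1 + ‖x‖ ^ 4) * eigSpan f c x ^ 2 := by
    refine integrable_of_le_pow_mul_exp ((continuous_const.add (continuous_norm.pow 4)).mul (hFc.pow 2)) 4 (A := C ^ 2)
      (fun x => ?_)
    rw [abs_of_nonneg (mul_nonneg (by positivity) (sq_nonneg _))]
    have hsq : eigSpan f c x ^ 2 ≤ (C * Real.exp (-‖x‖)) ^ 2 := by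
      rw [← sq_abs]; exact pow_le_pow_left₀ (abs_nonneg _) (hC x).1 2
    have he : Real.exp (-‖x‖) ≤ 1 := Real.exp_le_one_iff.mpr (neg_nonpos.mpr (norm_nonneg x))
    have he0 := Real.exp_pos (-‖x‖)
    have h4 : 1 + ‖x‖ ^ 4 ≤ (1 + ‖x‖) ^ 4 := by nlinarith [norm_nonneg x, sq_nonneg ‖x‖, pow_nonneg (norm_nonneg x) 3]
    calc (1 + ‖x‖ ^ 4) * eigSpan f c x ^ 2 ≤ (1 + ‖x‖) ^ 4 * (C * Real.exp (-‖x‖)) ^ 2 :=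
          mul_le_mul h4 hsq (sq_nonneg _) (by positivity)
      _ = C ^ 2 * ((1 + ‖x‖) ^ 4 * Real.exp (-‖x‖)) * Real.exp (-‖x‖) := by ring
      _ ≤ C ^ 2 * ((1 + ‖x‖) ^ 4 * Real.exp (-‖x‖)) * 1 := by gcongr
      _ = C ^ 2 * ((1 + ‖x‖) ^ 4 * Real.exp (-‖x‖)) := mul_one _
  have hdom : ∀ (w : ZM → ℝ), (∀ x, 0 ≤ w x) → ∀ x, w x * (g - eigSpan f c) x ^ 2 ≤ 2 * (w x * g x ^ 2) + 2 * (w x * eigSpan f c x ^ 2) :=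
    fun w hw x => by
      simp only [Pi.sub_apply]
      nlinarith [hw x, mul_nonneg (hw x) (sq_nonneg (g x + eigSpan f c x))]
  have hrw : Integrable fun x => (1 + ‖x‖ ^ 4) * (g - eigSpan f c) x ^ 2 := by
    have hD : Integrable fun x => 2 * ((1 + ‖x‖ ^ 4) * g x ^ 2) + 2 * ((1 + ‖x‖ ^ 4) * eigSpan f c x ^ 2) :=
      (hgw.const_mul 2).add (hwF.const_mul 2)
    refine hD.mono'
      (((continuous_const.add (continuous_norm.pow 4)).measurable.mul (hrm.pow_const 2)).aestronglyMeasurable)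
      (Eventually.of_forall fun x => ?_)
    rw [Real.norm_of_nonneg (mul_nonneg (by positivity) (sq_nonneg _))]
    exact hdom (fun x => 1 + ‖x‖ ^ 4) (fun x => by positivity) x
  have hrV : Integrable fun x => luscherPotential x * (g - eigSpan f c) x ^ 2 := by
    have hD : Integrable fun x => 2 * (luscherPotential x * g x ^ 2) + 2 * (luscherPotential x * eigSpan f c x ^ 2) :=
      (hgV.const_mul 2).add (hFK.integrable_potential_sq.const_mul 2)
    refine hD.mono'
      ((continuous_luscherPotential.measurable.mul (hrm.pow_const 2)).aestronglyMeasurable) (Eventually.of_forall fun x => ?_)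
    rw [Real.norm_of_nonneg (mul_nonneg (luscherPotential_nonneg x) (sq_nonneg _))]
    exact hdom luscherPotential luscherPotential_nonneg x
  -- `V F r = V F g − V F²`; `V F g` integrable: `|V F g| ≤ ½ V (F² + g²)`
  have hVFr : Integrable fun x => luscherPotential x * (eigSpan f c x * (g - eigSpan f c) x) := by
    have hD : Integrable fun x => (luscherPotential x * g x ^ 2 + luscherPotential x * eigSpan f c x ^ 2) / 2 +
        luscherPotential x * eigSpan f c x ^ 2 := ((hgV.add hFK.integrable_potential_sq).div_const 2).add hFK.integrable_potential_sq
    refine hD.mono'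
      ((continuous_luscherPotential.measurable.mul (hFc.measurable.mul hrm)).aestronglyMeasurable)
      (Eventually.of_forall fun x => ?_)
    simp only [Pi.sub_apply, Real.norm_eq_abs]
    have hV := luscherPotential_nonneg x
    rw [abs_mul, abs_of_nonneg hV]
    have : |eigSpan f c x * (g x - eigSpan f c x)| ≤ (g x ^ 2 + eigSpan f c x ^ 2) / 2 + eigSpan f c x ^ 2 := by
      rw [abs_le]; constructor <;> nlinarith [sq_nonneg (g x - eigSpan f c x), sq_nonneg (g x + eigSpan f c x), sq_nonneg (eigSpan f c x)]
    calc luscherPotential x * |eigSpan f c x * (g x - eigSpan f c x)|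
        ≤ luscherPotential x * ((g x ^ 2 + eigSpan f c x ^ 2) / 2 + eigSpan f c x ^ 2) := mul_le_mul_of_nonneg_left this hV
      _ = (luscherPotential x * g x ^ 2 + luscherPotential x * eigSpan f c x ^ 2) / 2 + luscherPotential x * eigSpan f c x ^ 2 := by
          ring
  -- orthogonality
  have hfj : ∀ j, IsKacFn (f j) := isKacFn_of_isEigenFamily hf
  have Igf : ∀ j, Integrable fun x => g x * f j x := fun j =>
    hgi.mul_bdd (hf.1 j 0).continuous.aestronglyMeasurable (ae_of_all _ fun x => by
      rw [Real.norm_eq_abs]; exact ((hf.2.2.2.2 j).abs_le.choose_spec x))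
  have horth : ∀ j, ∫ x, (g - eigSpan f c) x * f j x = 0 := by
    intro j
    have Iij : ∀ i, Integrable fun x => c i * (f i x * f j x) := fun i => ((hfj i).integrable_mul (hfj j)).const_mul _
    have e : ∫ x, (g - eigSpan f c) x * f j x = ∫ x, (g x * f j x - ∑ i, c i * (f i x * f j x)) :=
      integral_congr_ae (Eventually.of_forall fun x => by
        simp only [Pi.sub_apply, eigSpan_apply, sub_mul, Finset.sum_mul]
        congr 1; exact Finset.sum_congr rfl fun i _ => by ring)
    rw [e, integral_sub (Igf j) (integrable_finsetSum _ fun i _ => Iij i), integral_finsetSum _ fun i _ => Iij i]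
    simp_rw [integral_const_mul, hf.2.2.1 _ j]
    simp [hc j]
  -- Pythagoras: `g = r + F`, `∫ (r + F)² = ∫r² + 2Σc_j⟨r,f_j⟩ + Σc_j²`
  have hr2 : Integrable fun x => (g - eigSpan f c) x ^ 2 := integrable_sq_of_bounded_integrable hrm hrb hri
  have hpyth : ∫ x, g x ^ 2 = (∫ x, (g - eigSpan f c) x ^ 2) + ∑ j, c j ^ 2 := by
    have IrF : Integrable fun x => (g - eigSpan f c) x * eigSpan f c x :=
      hri.mul_bdd (c := C) hFc.aestronglyMeasurable (ae_of_all _ fun x => by rw [Real.norm_eq_abs]; exact hFb x)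
    have hrF0 : ∫ x, (g - eigSpan f c) x * eigSpan f c x = 0 := by
      have Irf : ∀ j, Integrable fun x => c j * ((g - eigSpan f c) x * f j x) := fun j =>
        (hri.mul_bdd (hf.1 j 0).continuous.aestronglyMeasurable (ae_of_all _ fun x => by
          rw [Real.norm_eq_abs]; exact ((hf.2.2.2.2 j).abs_le.choose_spec x))).const_mul _
      have e : ∫ x, (g - eigSpan f c) x * eigSpan f c x = ∫ x, ∑ j, c j * ((g - eigSpan f c) x * f j x) :=
        integral_congr_ae (Eventually.of_forall fun x => by
          simp only [eigSpan_apply, Finset.mul_sum]; exact Finset.sum_congr rfl fun j _ => by ring)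
      rw [e, integral_finsetSum _ fun j _ => Irf j]
      exact Finset.sum_eq_zero fun j _ => by rw [integral_const_mul, horth j, mul_zero]
    have hF2eq : ∫ x, eigSpan f c x ^ 2 = ∑ j, c j ^ 2 := by
      have h := l2sq_add_span hf isKacFn_zero c
      have hz : l2sq (0 : ZM → ℝ) = 0 := by simp [l2sq]
      have hz2 : ∀ j, ∫ x, (0 : ZM → ℝ) x * f j x = 0 := fun j => by simp
      simp only [hz, hz2, mul_zero, Finset.sum_const_zero, zero_add] at h
      rw [l2sq] at h
      exact h
    have I1 : Integrable fun x => (g - eigSpan f c) x ^ 2 + 2 * ((g - eigSpan f c) x * eigSpan f c x) := hr2.add (IrF.const_mul _)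
    calc ∫ x, g x ^ 2 = ∫ x, ((g - eigSpan f c) x ^ 2 + 2 * ((g - eigSpan f c) x * eigSpan f c x) + eigSpan f c x ^ 2) :=
          integral_congr_ae (Eventually.of_forall fun x => by simp only [Pi.sub_apply]; ring)
      _ = (∫ x, (g - eigSpan f c) x ^ 2) + 2 * (∫ x, (g - eigSpan f c) x * eigSpan f c x) + ∫ x, eigSpan f c x ^ 2 := by
          rw [integral_add I1 hF2, integral_add hr2 (IrF.const_mul _), integral_const_mul]
      _ = (∫ x, (g - eigSpan f c) x ^ 2) + ∑ j, c j ^ 2 := by rw [hrF0, hF2eq]; ring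
  exact ⟨hrm, ⟨M + C, hrb⟩, hri, hrinv, hrw, hrV, hVFr, horth, hpyth⟩

/-- **The almost-orthogonality budget** of `u = P_{t/2} r`: there is `Θ ≥ 0` (family only) with
`Σ_j ⟨P_{t/2} r, f_j⟩² ≤ t Θ ∫ r²` whenever `r ⊥ f_j` (bounded measurable integrable `r`, `0 < t`). [folklore] -/
theorem sum_sq_integral_heatSmooth_mul_le : ∃ Θ : ℝ, 0 ≤ Θ ∧ ∀ t : ℝ, 0 < t → ∀ (r : ZM → ℝ), Measurable r →
    ∀ M : ℝ, (∀ x, |r x| ≤ M) → Integrable r → (∀ j, ∫ x, r x * f j x = 0) →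
      ∑ j, (∫ x, heatSmooth (t / 2) r x * f j x) ^ 2 ≤ t * Θ * ∫ x, r x ^ 2 := by
  obtain ⟨C, hC0, hC⟩ := exists_uniform_expDecay₂ hf.2.2.2.2
  have hd : ∀ j, Differentiable ℝ (f j) := fun j => differentiable_of_contDiff_two (hf.1 j 2)
  -- `f_j` data for the Ledoux defect
  have h0 : ∀ j z, ‖f j z‖ ≤ C := fun j z => by
    rw [Real.norm_eq_abs]
    exact ((hC j z).1).trans (by nlinarith [Real.exp_le_one_iff.mpr (neg_nonpos.mpr (norm_nonneg z)), Real.exp_pos (-‖z‖)])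
  have h1 : ∀ j z, ‖fderiv ℝ (f j) z‖ ≤ 3 * (C * Real.exp (-‖z‖)) := fun j z =>
    norm_fderiv_le_of_pderiv_le (by positivity) (fun p => (hC j z).2.1 p)
  have h1' : ∀ j z, ‖fderiv ℝ (f j) z‖ ≤ 3 * C := fun j z =>
    (h1 j z).trans (by nlinarith [Real.exp_le_one_iff.mpr (neg_nonpos.mpr (norm_nonneg z)), Real.exp_pos (-‖z‖)])
  have hf2 : ∀ j, Integrable fun z => f j z ^ 2 := fun j => (isKacFn_of_isEigenFamily hf j).integrable_sq
  have hD2 : ∀ j, Integrable fun z => ‖fderiv ℝ (f j) z‖ ^ 2 := fun j =>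
    integrable_sq_of_le_exp ((hf.1 j 1).continuous_fderiv one_ne_zero).norm (A := 3 * C) (fun z => by
      rw [abs_of_nonneg (norm_nonneg _)]; linarith [h1 j z])
  set Θ : ℝ := (1 / 4 : ℝ) * ∑ j, ∫ z, ‖fderiv ℝ (f j) z‖ ^ 2 with hΘ
  have hΘ0 : 0 ≤ Θ := by positivity
  refine ⟨Θ, hΘ0, fun t ht r hrm M hrb hri horth => ?_⟩
  have hr0 : 0 ≤ ∫ x, r x ^ 2 := integral_nonneg fun x => sq_nonneg _
  have hj : ∀ j, (∫ x, heatSmooth (t / 2) r x * f j x) ^ 2 ≤ (∫ x, r x ^ 2) * (t / 4 * ∫ z, ‖fderiv ℝ (f j) z‖ ^ 2) := by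
    intro j
    have h := abs_integral_heatSmooth_mul_le (half_pos ht) hrm hrb hri (hf.1 j 1) (h0 j) (h1' j) (hf2 j) (hD2 j) (horth j)
    have hD0 : 0 ≤ ∫ z, ‖fderiv ℝ (f j) z‖ ^ 2 := integral_nonneg fun z => sq_nonneg _
    have e : t / 2 / 2 * ∫ z, ‖fderiv ℝ (f j) z‖ ^ 2 = t / 4 * ∫ z, ‖fderiv ℝ (f j) z‖ ^ 2 := by ring
    rw [e] at h
    have hsq := pow_le_pow_left₀ (abs_nonneg _) h 2
    rw [sq_abs, mul_pow, Real.sq_sqrt hr0, Real.sq_sqrt (by positivity)] at hsq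
    exact hsq
  calc ∑ j, (∫ x, heatSmooth (t / 2) r x * f j x) ^ 2 ≤ ∑ j, (∫ x, r x ^ 2) * (t / 4 * ∫ z, ‖fderiv ℝ (f j) z‖ ^ 2) :=
        Finset.sum_le_sum fun j _ => hj j
    _ = t * Θ * ∫ x, r x ^ 2 := by rw [hΘ, ← Finset.mul_sum, ← Finset.mul_sum]; ring

end Remainder

end Summit.QuantumFields.YangMills.Theorems.FemtoTransferGap

end
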